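import Literature.IUT.HodgeArakelov.BadPlaceSettingOfUnderline
import Mathlib.GroupTheory.QuotientGroup.Basic

/-!
# [IUTchII] Rmk 2.1.1 (i) / Def 2.3 (i) at the [EtTh] model: `Gal(Y_v/X̲_v) ≅ l·ℤ ⊆ ℤ ≅ Gal(Y_v/X_v)`, `Gal(X̲_v/X_v) ≅ ℤ/lℤ`

S. Mochizuki, *Inter-universal Teichmüller theory II*, kurims manuscript (Dec. 2020), §2, Rmk. 2.1.1 (i) p. 65 ("exact sequence
`1 → Gal(Ÿ_v/Y_v) → Gal(Ÿ_v/X_v) → Gal(Y_v/X_v) → 1`, where `Gal(Y_v/X_v)` may be identified with the subgroup `l·ℤ ⊆ ℤ`"),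
Def. 2.3 (i) p. 67 ([IUTchII] Rmk 2.1.1 (i), kurims p.65) [claim: Mochizuki2012, status: disputed] (D-0012 claim key; series
status DISPUTED — elementary quotient computations over abc-iut-L2's [EtTh] data only; nothing of the series is asserted);
[EtTh] §1 p. 12 ("a natural surjection `Π^tp_X ↠ Z`"), Def. 2.1 p. 36, Def. 2.5 (i) p. 39 [cite: MochizukiEtTh2009, Def 2.1 p.36].
PROOF-ONLY sequel (abc-iut cell, seat abc-iut-L6-t19 gen 5) of `BadPlaceSettingOfUnderline.lean`; no definitions.

THE TEXTUAL PIVOT of finding F-L6t19g5-1, kernel-certified at the model: for abc-iut-L2's [EtTh] §1 curve `X` of type `(1,1)`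
the Galois group of the `ℤ`-covering `Y → X` is ALL of `ℤ` (`toZ : Π^tp_X ↠ ℤ`), whereas for print's `X_v = X̲_v` (abc-iut-L2-t7's
`Π^tp_X̲ = GtpXu = toZ⁻¹(l·ℤ)`) it is the subgroup `l·ℤ` — exactly the sentence of Rmk. 2.1.1 (i):

* `ThetaSetting.quotientGtpY_equiv_int` — `Π^tp_X / Π^tp_Y ≃* ℤ` (`Gal(Y/X) ≅ ℤ`, the `(1,1)` curve);
* **`ThetaSetting.quotientGtpXu_GtpY_equiv_lZ`** — `Π^tp_X̲ / Π^tp_Y ≃* l·ℤ` ("`Gal(Y_v/X_v)` may be identified with the subgroup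
  `l·ℤ ⊆ ℤ`" — `X_v = X̲_v`);
* `ThetaSetting.quotientGtpXu_equiv_zmod` — `Π^tp_X / Π^tp_X̲ ≃* ℤ/lℤ` (`Gal(X̲_v/X_v) ≅ Q ≅ ℤ/lℤ`, [EtTh] Def. 2.1; abc-iut-L2-t7's
  `toQ`, `ker_toQ`, `toQ_surjective` BY NAME);
* `BadPlaceSetting.ofUnderline_galois` — the bundle at the print-level model `ofUnderline` (whose `PiXplain` IS `Π^tp_X̲` and whose
  `refY` IS `Π^tp_Y`).

Nothing here takes a side on [IUTchIII] Cor. 3.12; typed ≠ proved.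
-/

noncomputable section

namespace Literature.AnabelianGeometry.EtaleTheta

namespace ThetaSetting

variable {p : ℕ} [Fact p.Prime] (D : ThetaSetting p) (l : ℕ)

/-- **`Gal(Y/X) ≅ ℤ` for the `(1,1)` curve**: `Π^tp_X / Π^tp_Y ≃* Z = ℤ`, `Π^tp_Y = Ker(toZ)` (`= D.GtpY` definitionally;
stated with the kernel so that the quotient group structure is found by instance search) ([EtTh] §1 p. 12 "a natural surjection
`Π^tp_X ↠ Z`"; abc-iut-L2-t1's fields `toZ`, `toZ_surjective`).  PROVED (first isomorphism theorem).
[cite: MochizukiEtTh2009, §1 p.12] -/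
theorem quotientGtpY_equiv_int : Nonempty (D.PiTemp ⧸ D.toZ.ker ≃* Multiplicative ℤ) :=
  ⟨QuotientGroup.quotientKerEquivOfSurjective D.toZ D.toZ_surjective⟩

/-- **`Gal(X̲_v/X_v) ≅ ℤ/lℤ`**: `Π^tp_X / Π^tp_X̲ ≃* ℤ/lℤ` (`Π^tp_X̲ = toZ⁻¹(l·ℤ) = Ker(Π^tp_X ↠ Q)`, [EtTh] Def. 2.1 "a free
`(ℤ/lℤ)`-module `Q` of rank `1`"; abc-iut-L2-t7's `toQ`, `ker_toQ`, `toQ_surjective` BY NAME).  PROVED.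
[cite: MochizukiEtTh2009, Def 2.1 p.36] -/
theorem quotientGtpXu_equiv_zmod : Nonempty (D.PiTemp ⧸ D.GtpXu l ≃* Multiplicative (ZMod l)) :=
  ⟨(QuotientGroup.quotientMulEquivOfEq (D.ker_toQ l)).symm.trans
    (QuotientGroup.quotientKerEquivOfSurjective (D.toQ l) (D.toQ_surjective l))⟩

/-- **"`Gal(Y_v/X_v)` may be identified with the subgroup `l·ℤ ⊆ ℤ`"** ([IUTchII] Rmk. 2.1.1 (i), with `X_v = X̲_v` of type
`(1, l-tors)`): `Π^tp_X̲ / Π^tp_Y ≃* l·ℤ` — the restriction of `toZ` to `Π^tp_X̲ = toZ⁻¹(l·ℤ)` maps ONTO `l·ℤ`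
(abc-iut-L2-t7's `map_toZ_GtpXu`) with kernel `Π^tp_Y`.  PROVED. ([IUTchII] Rmk 2.1.1 (i), kurims p.65) [claim: Mochizuki2012, status: disputed] -/
theorem quotientGtpXu_GtpY_equiv_lZ :
    Nonempty (↥(D.GtpXu l) ⧸ D.toZ.ker.subgroupOf (D.GtpXu l) ≃* ↥(lZ l)) := by
  -- the restriction of `toZ` to `Π^tp_X̲`, corestricted to `l·ℤ`
  let φ : ↥(D.GtpXu l) →* ↥(lZ l) := (D.toZ.comp (D.GtpXu l).subtype).codRestrict (lZ l) fun g => g.2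
  have hφ : Function.Surjective φ := by
    rintro ⟨z, hz⟩
    have hz' : z ∈ (D.GtpXu l).map D.toZ := by rw [D.map_toZ_GtpXu]; exact hz
    obtain ⟨g, hg, hgz⟩ := hz'
    exact ⟨⟨g, hg⟩, Subtype.ext hgz⟩
  have hker : φ.ker = D.toZ.ker.subgroupOf (D.GtpXu l) := by
    ext g
    rw [MonoidHom.mem_ker, Subgroup.mem_subgroupOf, MonoidHom.mem_ker, Subtype.ext_iff]
    exact Iff.rfl
  exact ⟨(QuotientGroup.quotientMulEquivOfEq hker).symm.trans (QuotientGroup.quotientKerEquivOfSurjective φ hφ)⟩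

end ThetaSetting

end Literature.AnabelianGeometry.EtaleTheta

namespace Literature.IUT.HodgeArakelov

open Literature.AnabelianGeometry.EtaleTheta

variable {p : ℕ} [Fact p.Prime] {D : Literature.AnabelianGeometry.EtaleTheta.ThetaSetting p}
  {E : D.EtaleThetaData} {l : ℕ} (C : E.DoubleUnderline l) {N : ℕ+} (μ : D.CyclotomeMod l N)
  (hC : D.Compat) (hS : D.Sec2Hyps) (hl : l.Prime) (hp2 : p ≠ 2) (hpl : p ≠ l)
  (hζ : ∃ ζ : D.K, IsPrimitiveRoot ζ (4 * l)) {η : (C.thetaEnvData μ hC hS).PiYdd → MuN p N}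
  (hη : η ∈ (C.thetaEnvData μ hC hS).thetaCocycles)

/-- At the print-level model `BadPlaceSetting.ofUnderline`, `Π^tp_{X_v} := PiXplain` IS `Π^tp_X̲ = D.GtpXu l` and
`Π^tp_{Y_v} := refY` IS `Π^tp_Y = Ker(toZ)` viewed inside it (definitional). ([IUTchII] Prop 2.1, kurims p.64) [claim: Mochizuki2012, status: disputed] -/
theorem BadPlaceSetting.ofUnderline_refY_eq :
    ((BadPlaceSetting.ofUnderline C μ hC hS hl hp2 hpl hζ hη).PiXplain : Type) = ↥(D.GtpXu l) ∧
      (BadPlaceSetting.ofUnderline C μ hC hS hl hp2 hpl hζ hη).refY = D.toZ.ker.subgroupOf (D.GtpXu l) :=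
  ⟨rfl, rfl⟩

/-- **[IUTchII] Rmk. 2.1.1 (i) at the print-level model `BadPlaceSetting.ofUnderline`**: with `Π^tp_{X_v} := PiXplain = Π^tp_{X̲_v}`
and `Π^tp_{Y_v} := refY = Π^tp_Y` (`ofUnderline_refY_eq`), "`Gal(Y_v/X_v)` may be identified with the subgroup `l·ℤ ⊆ ℤ`":
`Π^tp_{X_v}/Π^tp_{Y_v} ≃* l·ℤ`, while for the `(1,1)` curve `Π^tp_X/Π^tp_Y ≃* ℤ`, and `Π^tp_X/Π^tp_{X_v} ≃* ℤ/lℤ`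
(`Gal(X̲_v/X_v)`).  PROVED. ([IUTchII] Rmk 2.1.1 (i), kurims p.65) [claim: Mochizuki2012, status: disputed] -/
theorem BadPlaceSetting.ofUnderline_galois :
    Nonempty (↥(D.GtpXu l) ⧸ D.toZ.ker.subgroupOf (D.GtpXu l) ≃* ↥(ThetaSetting.lZ l)) ∧
      Nonempty (D.PiTemp ⧸ D.toZ.ker ≃* Multiplicative ℤ) ∧
      Nonempty (D.PiTemp ⧸ D.GtpXu l ≃* Multiplicative (ZMod l)) :=
  ⟨D.quotientGtpXu_GtpY_equiv_lZ l, D.quotientGtpY_equiv_int, D.quotientGtpXu_equiv_zmod l⟩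

end Literature.IUT.HodgeArakelov

end
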